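import Literature.Computability.QuantumComplexity.Lemma24Instance
import Literature.Computability.QuantumComplexity.Lemma24InstanceFP
import Literature.Computability.Cryptography.QuantumCircuitDescFP
import Literature.Computability.Cryptography.QuantumCircuitProofs
import HarnessLib

/-!
# Aaronson–Ambainis Lemma 24 over the sign basis, XI-b/XIII: the instance has the shadow `instNL`; the Karp reduction

Last file of the discharge of `AaronsonAmbainis2018_lemma24_sign_hard` (`QSimSign.lean`; plan in
`Lemma24Catalysis.lean`): **every `PromiseBQP` problem Karp-reduces in polynomial time to QSIM over
the sign basis `{H, Z, CZ, CCZ}`** (S. Aaronson, A. Ambainis, *Forrelation*, SIAM J. Comput. 47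
(2018), §6, Lemma 24, p. 26: "follows from Shi"; here from the tree's Clifford+`T` families by
realification, catalytic `T` injection from one approximately prepared magic state, the OR of four
runs, the copy trick, and `24` blocks side by side — files I–X).

**Part XI-b (shadows).** `Lemma24Codes.lean` rebuilt the gate list of the reduction from the input
bits, `n`, `m` and the codes of the gates of the simulated circuit by list operations on *shadows*
(`NGate`: opcode and wire values), and `Lemma24InstanceFP.lean` computes the code of that shadow list
in polynomial time (`outF`, `outF_mem_FP`, `outF_inRec`). Here the shadow list is linked to the actual
instance `lemma24Instance C x` (`Lemma24Instance.lean`): the gate-by-gate **shadow**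
`shadow γ = ⟨opcode, wire values⟩` of a placed gate has the library's gate code (`code_shadow`, by
construction of `QGate.encode`; Arora–Barak 2009, §6.1), commutes with transport along the block/copy
embeddings as a translation of the wire values (`shadow_mapWiresGate`), and maps every word of the
reduction — the `NOT` and Toffoli words of `ReversibleCliffordT.lean`, the preparation, copies and OR
programs of `Lemma24Main.lean`, the sign-basis transcription of `Lemma24Transcribe.lean`, the gadget
and the copy word — onto its shadow word of `Lemma24Codes.lean` (`map_shadow_xWord`, …,
`map_shadow_blockCircuit`), whence **`map_shadow_lemma24Circuit`**
(`(lemma24Circuit C x).gates.map shadow = instNL n m (ofFn x) (C.gates.map shadow)`) and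
**`encode_lemma24Instance`** (the code of the instance is `⟨1^{24(4(n+m)+7)}, encList (codes of instNL …)⟩`,
the value computed by `outF`).

**Part XIII (the reduction).** Given `Q ∈ PromiseBQP`, witnessed by the uniform oracle-free
Clifford+`T` family `F` (ancillas `m = F.ancillas n`, circuit `C = F.circ n` on inputs of length `n`),
the reduction is the string function `reduction F : x ↦ outF ⟨x, ⟨bin |x|, ⟨1^m, code of C⟩⟩⟩` — the
input paired with the description of the `|x|`-th circuit (polynomial time by uniformity,
`QCircuitFamily.descFn_mem_FP_of_isUniform`; Arora–Barak 2009, §6.2), fed to `outF`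
(`reduction_mem_FP`). Its value is the code of `lemma24Instance C x` (`reduction_apply`), a
yes-instance (`A ≥ 3/5`) when `C` accepts `x` with probability `≥ 2/3` and a no-instance
(`|A| ≤ 1/100`) when it accepts with probability `≤ 1/3` (`isYes_lemma24Instance`,
`isNo_lemma24Instance`), which proves **`AaronsonAmbainis2018_lemma24_sign_hard_holds`**.

## References

* S. Aaronson, A. Ambainis, *Forrelation: a problem that optimally separates quantum from classical
  computing*, SIAM J. Comput. 47 (2018) 982–1038; arXiv:1411.5729, §6, Lemma 24 (p. 26).
* Y. Shi, *Both Toffoli and controlled-NOT need little help to do universal quantum computing*,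
  Quantum Inf. Comput. 3 (2003) 84–92.
* O. Goldreich, *On promise problems: a survey*, 2006, Def. 1.4 (Karp reductions of promise problems).
* S. Arora, B. Barak, *Computational Complexity: A Modern Approach*, CUP 2009, §1.3, §6.1, §6.2.
* M. A. Nielsen, I. L. Chuang, *Quantum Computation and Quantum Information*, CUP 2010, §4.2, §4.3.
-/

noncomputable section

namespace Literature.Computability.QuantumComplexity

open _root_.Computability Complexity Cryptography

namespace Lemma24

/-! ### List bookkeeping -/

section Lists

variable {α β γ : Type}

/-- A `flatMap` over `finRange k` whose body only depends on the value is a `flatMap` over `range k`. [folklore] -/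
theorem flatMap_finRange_eq_range {k : ℕ} (f : Fin k → List α) (g : ℕ → List α) (h : ∀ j, f j = g j) :
    (List.finRange k).flatMap f = (List.range k).flatMap g := by
  rw [← List.map_coe_finRange_eq_range, List.flatMap_map]
  exact flatMap_congr_mem fun j _ => h j

/-- Mapping a `flatMap`. [folklore] -/
theorem map_flatMap' (l : List α) (f : α → List β) (g : β → γ) : (l.flatMap f).map g = l.flatMap fun a => (f a).map g := by
  induction l with
  | nil => rfl
  | cons a l ih => rw [List.flatMap_cons, List.flatMap_cons, List.map_append, ih]

/-- A `flatMap` of a `flatMap`. [folklore] -/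
theorem flatMap_flatMap' (l : List α) (f : α → List β) (g : β → List γ) :
    (l.flatMap f).flatMap g = l.flatMap fun a => (f a).flatMap g := by
  induction l with
  | nil => rfl
  | cons a l ih => rw [List.flatMap_cons, List.flatMap_cons, List.flatMap_append, ih]

/-- A `flatMap` of a `filterMap` is a conditional `flatMap`. [folklore] -/
theorem flatMap_filterMap' (l : List α) (f : α → Option β) (g : β → List γ) :
    (l.filterMap f).flatMap g = l.flatMap fun a => match f a with | some b => g b | none => [] := by
  induction l with
  | nil => rfl
  | cons a l ih =>
    rw [List.filterMap_cons, List.flatMap_cons, ← ih]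
    cases f a with
    | none => rfl
    | some b => rw [List.flatMap_cons]

/-- A `flatMap` of a `map`. [folklore] -/
theorem flatMap_map' (l : List α) (f : α → β) (g : β → List γ) : (l.map f).flatMap g = l.flatMap fun a => g (f a) := by
  induction l with
  | nil => rfl
  | cons a l ih => rw [List.map_cons, List.flatMap_cons, List.flatMap_cons, ih]

end Lists

/-! ### The shadow of a placed gate -/

section Shadow

variable {G : QGateSet} [Encodable G.Op] {N N' : ℕ}

/-- **The shadow of a placed gate**: its opcode and the values of its wires (for an oracle gate,
the number of query wires in place of the opcode — a junk value, oracle gates do not occur).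
[cite: AroraBarak2009, §6.1] -/
def shadow : QGate G N → NGate
  | .gate g e => ⟨Encodable.encode g, List.ofFn fun i => (e i : ℕ)⟩
  | .oracle k e => ⟨k, List.ofFn fun i => (e i : ℕ)⟩

/-- **The code of the shadow of a (symbol) gate is the library's code of the gate.** [cite: AroraBarak2009, §6.1] -/
theorem code_shadow {γ : QGate G N} (h : γ.IsOracleFree) : (shadow γ).code = γ.encode := by
  cases γ with
  | gate g e => rfl
  | oracle k e => exact absurd h id

/-- The code of an oracle-free circuit is the list of the codes of the shadows of its gates. [cite: AroraBarak2009, §6.1] -/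
theorem encode_eq_encList_shadow {C : QCircuit G N} (hC : C.IsOracleFree) :
    C.encode = encList ((C.gates.map shadow).map NGate.code) := by
  rw [QCircuit.encode_eq_encList, List.map_map]
  congr 1
  exact List.map_congr_left fun γ hγ => (code_shadow (hC γ hγ)).symm

/-- **Transport along an embedding translates the shadow**: if `ι` acts on values as `θ`, the shadow
of the transported gate is the renamed shadow. [folklore] -/
theorem shadow_mapWiresGate {ι : Fin N ↪ Fin N'} {θ : ℕ → ℕ} (h : ∀ i, ((ι i : Fin N') : ℕ) = θ i)
    (γ : QGate G N) : shadow (mapWiresGate ι γ) = (shadow γ).ren θ := by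
  cases γ with
  | gate g e =>
    simp only [shadow, mapWiresGate, NGate.ren, List.map_ofFn, NGate.mk.injEq, true_and]
    congr 1
    funext i
    exact h (e i)
  | oracle k e =>
    simp only [shadow, mapWiresGate, NGate.ren, List.map_ofFn, NGate.mk.injEq, true_and]
    congr 1
    funext i
    exact h (e i)

/-- Shadows of a transported gate list. [folklore] -/
theorem map_shadow_map_mapWiresGate {ι : Fin N ↪ Fin N'} {θ : ℕ → ℕ} (h : ∀ i, ((ι i : Fin N') : ℕ) = θ i)
    (gs : List (QGate G N)) : (gs.map (mapWiresGate ι)).map shadow = (gs.map shadow).map (NGate.ren θ) := by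
  rw [List.map_map, List.map_map]
  exact List.map_congr_left fun γ _ => shadow_mapWiresGate h γ

end Shadow

/-! ### The Clifford+`T` words -/

section Words

variable {N : ℕ}

/-- The shadow of `H` on wire `i`. [folklore] -/
@[simp] theorem shadow_hOn (i : Fin N) : shadow (hOn i) = ⟨0, [(i : ℕ)]⟩ := rfl
/-- The shadow of `S` on wire `i`. [folklore] -/
@[simp] theorem shadow_sOn (i : Fin N) : shadow (sOn i) = ⟨1, [(i : ℕ)]⟩ := rfl
/-- The shadow of `T` on wire `i`. [folklore] -/
@[simp] theorem shadow_tOn (i : Fin N) : shadow (tOn i) = ⟨2, [(i : ℕ)]⟩ := rfl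
/-- The shadow of `CNOT` on wires `i, j`. [folklore] -/
@[simp] theorem shadow_cnotOn (i j : Fin N) (h : i ≠ j) : shadow (cnotOn i j h) = ⟨3, [(i : ℕ), (j : ℕ)]⟩ := rfl

/-- **The `NOT` word has the shadow `xWordN`.** [cite: NielsenChuang2010, Ex. 4.18] -/
theorem map_shadow_xWord (i : Fin N) : (xWord i).map shadow = xWordN i := rfl

/-- **The Toffoli word has the shadow `toffoliWordN`.** [cite: NielsenChuang2010, §4.3 Fig. 4.9] -/
theorem map_shadow_toffoliWord (a b c : Fin N) (hab : a ≠ b) (hac : a ≠ c) (hbc : b ≠ c) :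
    (toffoliWord a b c hab hac hbc).map shadow = toffoliWordN a b c := rfl

/-- The shadows of the compilation of a `NOT`. [folklore] -/
theorem map_shadow_compile_not (i : Fin N) : (RevOp.not i).compile.map shadow = xWordN i := rfl

/-- The shadows of the compilation of a Toffoli. [folklore] -/
theorem map_shadow_compile_toffoli (a b c : Fin N) (hab : a ≠ b) (hac : a ≠ c) (hbc : b ≠ c) :
    (RevOp.toffoli a b c hab hac hbc).compile.map shadow = toffoliWordN a b c := rfl

/-- The shadows of a compiled reversible program. [folklore] -/
theorem map_shadow_revCompile (ops : List (RevOp N)) :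
    (revCompile ops).map shadow = ops.flatMap fun op => op.compile.map shadow := by
  rw [revCompile, map_flatMap']

end Words

/-! ### The working circuit -/

section Main

variable {n m w : ℕ}

/-- **The preparation program has the shadow `prepNL`.** [cite: AaronsonAmbainis2018, §6 Lemma 24 (p. 26)] -/
theorem map_shadow_prep (x : QReg n) :
    (revCompile (prepOps (m := m) x)).map shadow = prepNL n m (List.ofFn x) := by
  rw [map_shadow_revCompile, prepOps, flatMap_map', prepWires, flatMap_flatMap', prepNL]
  refine flatMap_finRange_eq_range _ _ fun i => ?_
  rw [flatMap_filterMap']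
  refine flatMap_finRange_eq_range _ _ fun l => ?_
  have hl : (List.ofFn x).getD (l : ℕ) false = x l := by
    rw [List.getD_eq_getElem?_getD, List.getElem?_ofFn]
    simp [l.isLt]
  rw [hl]
  cases x l
  · rfl
  · exact map_shadow_compile_not _

/-- **The copies have the shadow `copiesN`.** [cite: NielsenChuang2010, §2.1.7] -/
theorem map_shadow_copiesGates (C : QCircuit cliffordT w) :
    (copiesGates C).map shadow = copiesN w (C.gates.map shadow) := by
  rw [copiesGates, map_flatMap', copiesN]
  refine flatMap_finRange_eq_range _ _ fun i => ?_
  rw [gates_mapWires, map_shadow_map_mapWiresGate (θ := (· + (i : ℕ) * w)) fun j => ?_]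
  · rfl
  · change (cw i j : ℕ) = _
    rw [cw_val, Nat.add_comm]

/-- **The OR program has the shadow `orN`.** [cite: AaronsonAmbainis2018, §6 Lemma 24 (p. 26)] -/
theorem map_shadow_or (w : ℕ) : (revCompile (orOps w)).map shadow = orN w := by
  rw [map_shadow_revCompile, orOps, orN]
  by_cases hw : 0 < w
  · rw [dif_pos hw, if_pos hw]
    have h0 : ((accW hw 0 : Fin (Kw w)) : ℕ) = 0 := by simp [accW]
    have h1 : ((accW hw 1 : Fin (Kw w)) : ℕ) = w := by simp [accW]
    have h2 : ((accW hw 2 : Fin (Kw w)) : ℕ) = 2 * w := by simp [accW]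
    have h3 : ((accW hw 3 : Fin (Kw w)) : ℕ) = 3 * w := by
      simp only [accW, cw_val, Nat.add_zero]
      rfl
    simp only [List.flatMap_cons, List.flatMap_nil, map_shadow_compile_not, map_shadow_compile_toffoli, h0, h1, h2, h3,
      anc1W_val, anc2W_val, flagW_val, orN.orN']
  · rw [dif_neg hw, if_neg hw]
    rfl

/-- **The working circuit has the shadow `mainNL`.** [cite: AaronsonAmbainis2018, §6 Lemma 24 (p. 26)] -/
theorem map_shadow_mainGates (C : QCircuit cliffordT (n + m)) (x : QReg n) :
    (mainGates C x).map shadow = mainNL n m (List.ofFn x) (C.gates.map shadow) := by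
  rw [mainGates, List.map_append, List.map_append, map_shadow_prep, map_shadow_copiesGates, map_shadow_or, mainNL]

end Main

/-! ### The transcription, the gadget, the copy word -/

section Transcribe

variable {K : ℕ}

/-- **The sign-basis word of a Clifford+`T` symbol gate has the shadow `realGatesN`.**
[cite: AaronsonAmbainis2018, §6 Lemma 24 (p. 26)] -/
theorem map_shadow_realGates (op : CliffordTOp) (e : Fin (cliffordT.arity op) ↪ Fin K) :
    (realGates (QGate.gate op e : QGate cliffordT K)).map shadow = realGatesN K (shadow (QGate.gate op e : QGate cliffordT K)) := by
  cases op <;> rfl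

/-- **The transcription of an oracle-free gate list has the shadow `flatMap realGatesN`.**
[cite: AaronsonAmbainis2018, §6 Lemma 24 (p. 26)] -/
theorem map_shadow_transcribe {gs : List (QGate cliffordT K)} (hgs : ∀ g ∈ gs, g.IsOracleFree) :
    (transcribe gs).map shadow = (gs.map shadow).flatMap (realGatesN K) := by
  rw [transcribe, map_flatMap', flatMap_map']
  refine flatMap_congr_mem fun γ hγ => ?_
  rcases γ with ⟨op, e⟩ | ⟨k, e⟩
  · exact map_shadow_realGates op e
  · exact absurd (hgs _ hγ) id

/-- **The placed gadget has the shadow `gadgetN`.** [cite: AaronsonAmbainis2018, §6 Lemma 24 (p. 26)] -/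
theorem map_shadow_gadgetR (K : ℕ) : (gadgetR K).map shadow = gadgetN K := by
  rw [gadgetR, gates_mapWires, gadget, List.map_map, List.map_map, gadgetN, gadgetN']
  refine List.map_congr_left fun o _ => ?_
  cases o <;> rfl

/-- **The copy word has the shadow `copyN`.** [cite: BennettBernsteinBrassardVazirani1997, Thm. 4.14 (proof)] -/
theorem map_shadow_copyGates {N : ℕ} (f f' : Fin N) (h : f ≠ f') : (copyGates f f' h).map shadow = copyN f f' := rfl

end Transcribe

/-! ### The block and the instance -/

section Block

variable {n m : ℕ}

/-- **The gates of a block before the copy have the shadow `gadgetN ++ flatMap realGatesN mainNL`.**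
[cite: AaronsonAmbainis2018, §6 Lemma 24 (p. 26)] -/
theorem map_shadow_blockReal {C : QCircuit cliffordT (n + m)} (hC : C.IsOracleFree) (x : QReg n) :
    (blockReal C x).map shadow =
      gadgetN (Kw (n + m)) ++ (mainNL n m (List.ofFn x) (C.gates.map shadow)).flatMap (realGatesN (Kw (n + m))) := by
  rw [blockReal, List.map_append, map_shadow_gadgetR, map_shadow_transcribe (mainGates_isOracleFree hC x),
    map_shadow_mainGates]

/-- **The block circuit has the shadow `blockNL`.** [cite: AaronsonAmbainis2018, §6 Lemma 24 (p. 26)] -/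
theorem map_shadow_blockCircuit {C : QCircuit cliffordT (n + m)} (hC : C.IsOracleFree) (x : QReg n) :
    (blockCircuit C x).gates.map shadow = blockNL n m (List.ofFn x) (C.gates.map shadow) := by
  rw [blockCircuit, copyTrick, List.map_append, List.map_append, List.map_reverse, map_shadow_blockReal hC,
    map_shadow_copyGates, blockNL]
  rfl

/-- **The instance has the shadow `instNL`.** [cite: AaronsonAmbainis2018, §6 Lemma 24 (p. 26)] -/
theorem map_shadow_lemma24Circuit {C : QCircuit cliffordT (n + m)} (hC : C.IsOracleFree) (x : QReg n) :
    (lemma24Circuit C x).gates.map shadow = instNL n m (List.ofFn x) (C.gates.map shadow) := by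
  rw [gates_lemma24Circuit, map_flatMap', instNL]
  refine flatMap_finRange_eq_range _ _ fun j => ?_
  rw [map_shadow_map_mapWiresGate (θ := (· + (j : ℕ) * (Kw (n + m) + 2 + 1))) fun i => ?_, map_shadow_blockCircuit hC]
  · rfl
  · rw [blkEmb_val, Nat.add_comm]

/-- **The code of the instance** is `⟨1^{24(4(n+m)+7)}, encList (codes of instNL)⟩` — the value of the
polynomial-time function `outF` on the record of the reduction (`Lemma24InstanceFP.outF_inRec`).
[cite: AaronsonAmbainis2018, §6 Lemma 24 (p. 26)] -/
theorem encode_lemma24Instance {C : QCircuit cliffordT (n + m)} (hC : C.IsOracleFree) (x : QReg n) :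
    (lemma24Instance C x).encode =
      boolPair (unaryEncodeNat (24 * (Kw (n + m) + 2 + 1)))
        (encList ((instNL n m (List.ofFn x) (C.gates.map shadow)).map NGate.code)) := by
  rw [QSimSignInstance.encode, ← map_shadow_lemma24Circuit hC x, ← encode_eq_encList_shadow (lemma24Circuit_isOracleFree C x)]
  rfl

end Block

/-! ### Well-formedness of the shadows of Clifford+`T` gates -/

/-- The shadow of a placed Clifford+`T` symbol gate is well-formed (`WfC`: opcode `≤ 2` on one wire, or `3` on two). [folklore] -/
theorem wfC_shadow {K : ℕ} (op : CliffordTOp) (e : Fin (cliffordT.arity op) ↪ Fin K) :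
    WfC (shadow (QGate.gate op e : QGate cliffordT K)) := by
  cases op
  · exact Or.inl ⟨Nat.zero_le _, (plH e 0 : ℕ), rfl⟩
  · refine Or.inl ⟨?_, (plS e 0 : ℕ), rfl⟩
    change (1 : ℕ) ≤ 2
    decide
  · exact Or.inl ⟨le_rfl, (plT e 0 : ℕ), rfl⟩
  · exact Or.inr ⟨rfl, (plC e 0 : ℕ), (plC e 1 : ℕ), rfl⟩

/-- The shadows of the gates of an oracle-free Clifford+`T` circuit are well-formed. [folklore] -/
theorem wfC_of_mem_map_shadow {K : ℕ} {C : QCircuit cliffordT K} (hC : C.IsOracleFree) :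
    ∀ g ∈ C.gates.map shadow, WfC g := by
  intro g hg
  obtain ⟨γ, hγ, hg⟩ := List.mem_map.1 hg
  subst hg
  rcases γ with ⟨op, e⟩ | ⟨k, e⟩
  · exact wfC_shadow op e
  · exact absurd (hC _ hγ) id

/-! ### The reduction -/

/-- **The reduction function** of a Clifford+`T` family `F`: the input `x` paired with the
description `⟨bin |x|, ⟨1^m, code of F.circ |x|⟩⟩` of the `|x|`-th circuit, fed to the assembly
`outF` of the instance code. [cite: AaronsonAmbainis2018, §6 Lemma 24 (p. 26)] -/
def reduction (F : QCircuitFamily cliffordT) : List Bool → List Bool :=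
  outF ∘ fanoutFn id F.descFn

/-- **The reduction is polynomial time** for a uniform family. [cite: AroraBarak2009, §1.3, §6.2] -/
theorem reduction_mem_FP {F : QCircuitFamily cliffordT} (hU : F.IsUniform) : reduction F ∈ FP :=
  comp_mem_FP outF_mem_FP (fanoutFn_mem_FP (PolyTimeComputable.id _) (QCircuitFamily.descFn_mem_FP_of_isUniform hU))

/-- The input record of `outF` is `⟨x, description⟩`, i.e. `inRec x m (shadows of the gates)` for an
oracle-free family. [folklore] -/
theorem fanoutFn_descFn_eq_inRec {F : QCircuitFamily cliffordT} (hF : F.IsOracleFree) (x : List Bool) :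
    fanoutFn id F.descFn x = inRec x (F.ancillas x.length) ((F.circ x.length).gates.map shadow) := by
  rw [fanoutFn_apply, QCircuitFamily.descFn_eq, encode_eq_encList_shadow (hF x.length)]
  rfl

/-- **The value of the reduction is the code of the QSIM instance of the `|x|`-th circuit on `x`.**
[cite: AaronsonAmbainis2018, §6 Lemma 24 (p. 26)] -/
theorem reduction_apply {F : QCircuitFamily cliffordT} (hF : F.IsOracleFree) (x : List Bool) :
    reduction F x = (lemma24Instance (F.circ x.length) x.get).encode := by
  rw [reduction, Function.comp_apply, fanoutFn_descFn_eq_inRec hF,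
    outF_inRec x _ (wfC_of_mem_map_shadow (hF x.length)), encode_lemma24Instance (hF x.length), List.ofFn_get]

end Lemma24

open Lemma24 in
/-- **Discharge of `AaronsonAmbainis2018_lemma24_sign_hard` (AA Lemma 24, hardness half, over the
sign basis):** every `PromiseBQP` problem Karp-reduces in polynomial time to QSIM over
`{H, Z, CZ, CCZ}`. For `Q ∈ PromiseBQP` decided by the uniform oracle-free Clifford+`T` family `F`,
the reduction `Lemma24.reduction F` is in `FP` and maps `x` to the code of `lemma24Instance (F.circ |x|) x`,
a yes-instance when `F` accepts `x` with probability `≥ 2/3` and a no-instance when it accepts with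
probability `≤ 1/3` (files I–XIII of the `Lemma24*` series). [cite: AaronsonAmbainis2018, §6 Lemma 24 (p. 26)] -/
theorem AaronsonAmbainis2018_lemma24_sign_hard_holds : AaronsonAmbainis2018_lemma24_sign_hard := by
  intro Q hQ
  obtain ⟨F, hfree, hU, hyes, hno⟩ := hQ
  refine ⟨reduction F, reduction_mem_FP hU, ?_, ?_⟩
  · intro x hx
    rw [reduction_apply hfree]
    exact (encode_mem_qSimSignProblem_yes_iff _).2
      (isYes_lemma24Instance (hfree _) (hyes x hx) (QCircuit.acceptProb_le_one_holds cliffordT_isUnitary_holds 0 _ _))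
  · intro x hx
    rw [reduction_apply hfree]
    exact (encode_mem_qSimSignProblem_no_iff _).2
      (isNo_lemma24Instance (hfree _) (hno x hx) (QCircuit.acceptProb_nonneg 0 _ _)
        (QCircuit.acceptProb_le_one_holds cliffordT_isUnitary_holds 0 _ _))

/-- **AA Lemma 24 over the sign basis, both halves stated, hardness proved**: the completeness
assembly of §6 (`aaronson_ambainis_kForrelation_complete_of_sign_steps`, `QSimSign.lean`) now only
awaits membership of FORRELATION and the sign-basis Theorem 25. [cite: AaronsonAmbainis2018, §6 Lemma 24 (p. 26)] -/
theorem aaronson_ambainis_kForrelation_complete_of_mem_of_thm25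
    (hmem : AaronsonAmbainis2018_kForrelation_mem) (h25 : AaronsonAmbainis2018_thm25_sign) :
    aaronson_ambainis_kForrelation_complete :=
  aaronson_ambainis_kForrelation_complete_of_sign_steps hmem AaronsonAmbainis2018_lemma24_sign_hard_holds h25

end Literature.Computability.QuantumComplexity

end
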